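import Summits.Ventures.PercRepro.NearDominant
import Summits.Ventures.PercRepro.SingleMergeDim
import Summits.Ventures.PercRepro.LemmaBPointed

/-!
# Lemma B two pairs beyond a dominant column, modulo a Marica–Schönheim statement with slack two

`DominantClass.lean` settles Lemma B when `crossCount ≤ columnCount i` and `NearDominantHolds.lean`
when `crossCount ≤ columnCount i + 1`. The next regime, `crossCount ≤ columnCount i + 2` (exactly two
antipodal pairs avoid the cell `x i`), is reduced here to ONE statement about set families, in the
spirit of `MSTightNoSplit` (p4 gen 8):

* `DiffBandCandidate` — **Marica–Schönheim with two units of slack for sandwiched families**: if `G`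
  is a down-set of configurations containing every singleton and `F` is a family all of whose
  within-family differences `A \ B` lie in `G`, while no member of `F` and no complement of a member
  lies in `G`, then `|F| + 2 ≤ |G|`. (Marica–Schönheim, `Finset.card_le_card_diffs`, gives `|F| ≤ |G|`
  with no sandwich hypothesis; the star `{0v : v ≠ 0}` with `G = {∅} ∪ singletons` shows the `+ 2`
  is sharp.) Exhaustively TRUE on `[4]` for every family (`|F| ≤ 10`) and on `[5]` for `|F| ≤ 8`
  (p4 gen 9, work/tight.py, work/invI.py; minimum of `|G| − |F|` over the class = 2, attained only
  by stars); the exact form `G = F \\ F` holds on `[6]` for `|F| ≤ 10`. A typed CANDIDATE Prop, never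
  asserted (`proofs/P4-gen9.md`).

The ingredients that make the column of Lemma B a sandwiched family, for EVERY monotone map
`c : Config S → Setoid (Fin 4)` with all three crossing-pair types present (no single-merge
hypothesis):

* `botSet c` — the `⊥`-members of the `{⊤, ⊥}` antipodal pairs (the complements of `goodSet c`),
  `(botSet c).card = topBotCount c`;
* `botSet_lowerSet` — the `⊥`-members form a DOWN-SET (monotonicity on both members of the pair);
* `cell_singleConfig_eq_bot_of_threeTypes` — every singleton configuration has cell `⊥`: of the
  three crossing points `X ∈ T₀₁`, `Y ∈ T₀₂`, `B ∈ T₁₂` or their complements, two containing `e`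
  lie in different crossing cells, and the meet of two distinct crossing cells is `⊥`
  (`SingleMergeDim.cell_singleConfig_eq_bot` needed the single-merge hypothesis);
  with `cell_compl_singleConfig_eq_top` every singleton lies in `botSet c`, so
  `card_add_one_le_topBotCount_of_threeTypes : Fintype.card S + 1 ≤ topBotCount c`;
* the column `columnSet cross4 c i` has its differences in `botSet c`
  (`compl_sdiff_mem_goodSet`), its members in the cell `x i ≠ ⊥` and their complements in a
  crossing cell `≠ ⊥` (`cross4_ne_bot`, `LemmaBPointed`).

Hence `columnCount_add_two_le_topBotCount_of_candidate` and the regime theorem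
`crossCount_le_topBotCount_of_le_columnCount_add_two`: `DiffBandCandidate →` for every monotone
`c`, `crossCount ≤ columnCount i + 2 → crossCount ≤ topBotCount` (the two-type case handled by
`crossCount_le_topBotCount_of_column` via `crossFam_eq_empty_of_not_threeTypes`).
-/

namespace PercRepro

open Finset

/-! ### The `⊥`-members of the good pairs form a down-set -/

section BotSet

variable {S : Type*} [Fintype S] [DecidableEq S] {k : ℕ}

open Classical in
/-- The `⊥`-members of the `{⊤, ⊥}` antipodal pairs: `c ω = ⊥` and `c ωᶜ = ⊤`. -/
noncomputable def botSet (c : Config S → Setoid (Fin k)) : Finset (Config S) :=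
  Finset.univ.filter fun ω => c ω = ⊥ ∧ c ωᶜ = ⊤

/-- Membership in `botSet`. -/
theorem mem_botSet {c : Config S → Setoid (Fin k)} {ω : Config S} :
    ω ∈ botSet c ↔ c ω = ⊥ ∧ c ωᶜ = ⊤ := by
  simp [botSet]

/-- `botSet c` is the complement image of `goodSet c`. -/
theorem botSet_eq_image_compl (c : Config S → Setoid (Fin k)) :
    botSet c = (goodSet c).image compl := by
  ext ω
  constructor
  · intro h
    rw [mem_botSet] at h
    refine Finset.mem_image.2 ⟨ωᶜ, ?_, compl_compl ω⟩
    simp only [goodSet, Finset.mem_filter, Finset.mem_univ, true_and, compl_compl]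
    exact ⟨h.2, h.1⟩
  · intro h
    obtain ⟨η, hη, rfl⟩ := Finset.mem_image.1 h
    simp only [goodSet, Finset.mem_filter, Finset.mem_univ, true_and] at hη
    rw [mem_botSet, compl_compl]
    exact ⟨hη.2, hη.1⟩

/-- The `⊥`-members are counted by `topBotCount`. -/
theorem card_botSet (c : Config S → Setoid (Fin k)) : (botSet c).card = topBotCount c := by
  rw [botSet_eq_image_compl, Finset.card_image_of_injective _ compl_injective,
    topBotCount_eq_card_goodSet]

/-- **The `⊥`-members form a down-set**: a configuration below a `⊥`-member of a good pair is
itself the `⊥`-member of a good pair. -/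
theorem botSet_lowerSet {c : Config S → Setoid (Fin k)} (hc : Monotone c) {W W' : Config S}
    (hW : W ∈ botSet c) (hle : W' ≤ W) : W' ∈ botSet c := by
  rw [mem_botSet] at hW ⊢
  constructor
  · exact le_bot_iff.1 (hW.1 ▸ hc hle)
  · exact top_unique (hW.2 ▸ hc (compl_le_compl hle))

/-- The empty configuration lies in `botSet c` as soon as `botSet c` is nonempty. -/
theorem bot_mem_botSet_of_mem {c : Config S → Setoid (Fin k)} (hc : Monotone c) {W : Config S}
    (hW : W ∈ botSet c) : (⊥ : Config S) ∈ botSet c :=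
  botSet_lowerSet hc hW bot_le

end BotSet

/-! ### Singletons have cell `⊥` for every monotone map with three crossing-pair types -/

section Singletons

variable {S : Type*} [Fintype S] [DecidableEq S]

omit [Fintype S] [DecidableEq S] in
/-- A configuration below two crossing points of DIFFERENT cells has cell `⊥`. -/
theorem cell_eq_bot_of_le_two (c : Config S → Setoid (Fin 4)) (hc : Monotone c)
    {ω A₁ A₂ : Config S} {a b : Fin 3} (h₁ : ω ≤ A₁) (h₂ : ω ≤ A₂) (ha : c A₁ = cross4 a)
    (hb : c A₂ = cross4 b) (hab : a ≠ b) : c ω = ⊥ := by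
  apply le_bot_iff.1
  calc c ω ≤ c A₁ ⊓ c A₂ := le_inf (hc h₁) (hc h₂)
    _ = cross4 a ⊓ cross4 b := by rw [ha, hb]
    _ = ⊥ := cross4_inf_eq_bot hab

omit [Fintype S] in
/-- **Singletons have cell `⊥`** for every monotone map with all three crossing-pair types (no
single-merge hypothesis): of the crossing points `X ∈ T₀₁`, `Y ∈ T₀₂`, `B ∈ T₁₂` and their
complements, two containing `e` lie in different cells. -/
theorem cell_singleConfig_eq_bot_of_threeTypes (c : Config S → Setoid (Fin 4)) (hc : Monotone c)
    (h3 : ThreeTypes c) (e : S) : c (singleConfig e) = ⊥ := by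
  obtain ⟨X, hX, hXc⟩ := h3 0 1 (by decide)
  obtain ⟨Y, hY, hYc⟩ := h3 0 2 (by decide)
  obtain ⟨B, hB, hBc⟩ := h3 1 2 (by decide)
  have memOf : ∀ (ω : Config S), ω e = true → singleConfig e ≤ ω :=
    fun ω h => (singleConfig_le_iff e ω).2 h
  have memOfc : ∀ (ω : Config S), ω e = false → singleConfig e ≤ ωᶜ :=
    fun ω h => (singleConfig_le_iff e ωᶜ).2 (by simp [h])
  cases hXe : X e
  · -- `e ∉ X`, so `e ∈ Xᶜ` (cell `x 1`)
    cases hBe : B e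
    · -- `e ∈ Bᶜ` (cell `x 2`)
      exact cell_eq_bot_of_le_two c hc (memOfc X hXe) (memOfc B hBe) hXc hBc (by decide)
    · -- `e ∈ B` (cell `x 1`): use the `Y` pair
      cases hYe : Y e
      · exact cell_eq_bot_of_le_two c hc (memOfc X hXe) (memOfc Y hYe) hXc hYc (by decide)
      · exact cell_eq_bot_of_le_two c hc (memOfc X hXe) (memOf Y hYe) hXc hY (by decide)
  · -- `e ∈ X` (cell `x 0`)
    cases hBe : B e
    · exact cell_eq_bot_of_le_two c hc (memOf X hXe) (memOfc B hBe) hX hBc (by decide)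
    · exact cell_eq_bot_of_le_two c hc (memOf X hXe) (memOf B hBe) hX hB (by decide)

/-- Every singleton is the `⊥`-member of a good pair (three types, monotone). -/
theorem singleConfig_mem_botSet (c : Config S → Setoid (Fin 4)) (hc : Monotone c)
    (h3 : ThreeTypes c) (e : S) : singleConfig e ∈ botSet c :=
  mem_botSet.2 ⟨cell_singleConfig_eq_bot_of_threeTypes c hc h3 e,
    cell_compl_singleConfig_eq_top c hc h3 e⟩

omit [Fintype S] in
/-- Distinct coordinates give distinct singleton configurations. -/
theorem singleConfig_injective : Function.Injective (singleConfig (S := S)) := by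
  intro e e' h
  have := congrFun h e
  simp only [singleConfig, decide_true] at this
  by_contra hne
  simp [hne] at this

/-- **`topBotCount ≥ |S| + 1`** for every monotone map with three crossing-pair types: the empty
configuration and the `|S|` singletons are `⊥`-members of good pairs. -/
theorem card_add_one_le_topBotCount_of_threeTypes (c : Config S → Setoid (Fin 4))
    (hc : Monotone c) (h3 : ThreeTypes c) : Fintype.card S + 1 ≤ topBotCount c := by
  rw [← card_botSet]
  have hsub : insert (⊥ : Config S) (Finset.univ.image (singleConfig (S := S))) ⊆ botSet c := by
    intro ω hω
    rcases Finset.mem_insert.1 hω with rfl | hω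
    · rw [mem_botSet]
      exact ⟨cell_bot_eq_bot c hc h3, by
        rw [compl_bot]
        obtain ⟨X, hX, hXc⟩ := h3 0 1 (by decide)
        apply top_unique
        calc (⊤ : Setoid (Fin 4)) = cross4 0 ⊔ cross4 1 := (cross4_sup_eq_top (by decide)).symm
          _ = c X ⊔ c Xᶜ := by rw [hX, hXc]
          _ ≤ c ⊤ := sup_le (hc le_top) (hc le_top)⟩
    · obtain ⟨e, -, rfl⟩ := Finset.mem_image.1 hω
      exact singleConfig_mem_botSet c hc h3 e
  have hcard : (insert (⊥ : Config S) (Finset.univ.image (singleConfig (S := S)))).card =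
      Fintype.card S + 1 := by
    rw [Finset.card_insert_of_notMem, Finset.card_image_of_injective _ singleConfig_injective,
      Finset.card_univ]
    intro h
    obtain ⟨e, -, he⟩ := Finset.mem_image.1 h
    have := congrFun he e
    simp [singleConfig] at this
  exact hcard ▸ Finset.card_le_card hsub

end Singletons

/-! ### The candidate and the reduction -/

/-- **CANDIDATE (B2): Marica–Schönheim with two units of slack for sandwiched families.** For a
finite nonempty `S`, a down-set `G` of configurations containing every singleton, and a family `F`
whose within-family differences `A \ B` lie in `G` while neither its members nor their complements
do, `|F| + 2 ≤ |G|`. Marica–Schönheim (`Finset.card_le_card_diffs`) gives `|F| ≤ |G|` without the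
sandwich hypotheses; the star `{{0, v} : v ≠ 0}` with `G = {∅} ∪ singletons` shows that `+ 2` is
sharp. Typed hypothesis; exhaustive evidence on `[4]` (`|F| ≤ 10`) and `[5]` (`|F| ≤ 8`) (module
docstring); never asserted. -/
def DiffBandCandidate : Prop :=
  ∀ {S : Type} [Fintype S] [DecidableEq S] [Nonempty S] (G F : Finset (Config S)),
    (∀ W ∈ G, ∀ W' ≤ W, W' ∈ G) → (∀ e : S, singleConfig e ∈ G) →
    (∀ A ∈ F, ∀ B ∈ F, A \ B ∈ G) → (∀ A ∈ F, A ∉ G) → (∀ A ∈ F, Aᶜ ∉ G) →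
    F.card + 2 ≤ G.card

section Reduction

variable {S : Type} [Fintype S] [DecidableEq S]

open Classical in
/-- **The column is a sandwiched family**: modulo `DiffBandCandidate`, for every monotone map
with three crossing-pair types, `columnCount i + 2 ≤ topBotCount`. -/
theorem columnCount_add_two_le_topBotCount_of_candidate (hB : DiffBandCandidate)
    (c : Config S → Setoid (Fin 4)) (hc : Monotone c) (h3 : ThreeTypes c) (i : Fin 3) :
    columnCount cross4 c i + 2 ≤ topBotCount c := by
  haveI : Nonempty S := by
    -- with no coordinate the unique configuration equals its complement and carries one cell
    by_contra hS
    rw [not_nonempty_iff] at hS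
    obtain ⟨ω, h1, h2⟩ := h3 0 1 (by decide)
    have hω : ωᶜ = ω := funext fun s => (hS.false s).elim
    rw [hω, h1] at h2
    exact absurd (cross4_injective h2) (by decide)
  rw [← card_botSet, columnCount]
  refine hB (botSet c) (columnSet cross4 c i) (fun W hW W' hle => botSet_lowerSet hc hW hle)
    (singleConfig_mem_botSet c hc h3) ?_ ?_ ?_
  · intro A hA B hB'
    rw [mem_botSet]
    have := compl_sdiff_mem_goodSet cross4 c cross4_isCrossingFamily hc hA hB'
    simp only [goodSet, Finset.mem_filter, Finset.mem_univ, true_and, compl_compl] at this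
    exact ⟨this.2, this.1⟩
  · intro A hA hG
    simp only [columnSet, Finset.mem_filter, Finset.mem_univ, true_and] at hA
    exact cross4_ne_bot i (hA.1 ▸ (mem_botSet.1 hG).1)
  · intro A hA hG
    simp only [columnSet, Finset.mem_filter, Finset.mem_univ, true_and] at hA
    obtain ⟨-, j, -, hj⟩ := hA
    exact cross4_ne_bot j (hj ▸ (mem_botSet.1 hG).1)

/-- If some ordered crossing-pair type is absent then every bad pair touches the third cell. -/
theorem crossFam_eq_empty_of_not_threeTypes {c : Config S → Setoid (Fin 4)}
    (h : ¬ ThreeTypes c) :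
    ∃ i : Fin 3, ∀ j j' : Fin 3, j ≠ i → j' ≠ i → crossFam cross4 c j j' = ∅ := by
  simp only [ThreeTypes, not_forall, not_exists, not_and] at h
  obtain ⟨i₀, j₀, hne, hno⟩ := h
  have hthird : ∀ i₀ j₀ : Fin 3, i₀ ≠ j₀ → ∃ k : Fin 3, k ≠ i₀ ∧ k ≠ j₀ ∧
      ∀ j : Fin 3, j ≠ k → j = i₀ ∨ j = j₀ := by decide
  obtain ⟨k, hki, hkj, hk⟩ := hthird i₀ j₀ hne
  refine ⟨k, fun j j' hj hj' => ?_⟩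
  apply Finset.eq_empty_of_forall_notMem
  intro ω hω
  obtain ⟨hjj', h1, h2⟩ := (mem_crossFam cross4 c).1 hω
  rcases hk j hj with rfl | rfl <;> rcases hk j' hj' with rfl | rfl
  · exact hjj' rfl
  · exact hno ω h1 h2
  · exact hno ωᶜ h2 (by rw [compl_compl]; exact h1)
  · exact hjj' rfl

/-- **Lemma B two pairs beyond a dominant column, modulo `DiffBandCandidate`**: for every monotone
`c : Config S → Setoid (Fin 4)`, `crossCount ≤ columnCount i + 2 → crossCount ≤ topBotCount`. -/
theorem crossCount_le_topBotCount_of_le_columnCount_add_two (hB : DiffBandCandidate)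
    (c : Config S → Setoid (Fin 4)) (hc : Monotone c) (i : Fin 3)
    (h : crossCount cross4 c ≤ columnCount cross4 c i + 2) :
    crossCount cross4 c ≤ topBotCount c := by
  by_cases h3 : ThreeTypes c
  · exact h.trans (columnCount_add_two_le_topBotCount_of_candidate hB c hc h3 i)
  · obtain ⟨i', hi'⟩ := crossFam_eq_empty_of_not_threeTypes h3
    exact crossCount_le_topBotCount_of_column cross4 c cross4_isCrossingFamily hc i' hi'

end Reduction

end PercRepro
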